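import Literature.NumberTheory.EllipticCurves.ZpExtensionEisensteinTwistUnramifiedTransferProofs
import Literature.NumberTheory.EllipticCurves.ZpExtensionEisensteinDVRSetting
import Literature.NumberTheory.EllipticCurves.ZpExtensionEisensteinSelmerUnramifiedProofs
import Literature.NumberTheory.EllipticCurves.AnticyclotomicInertPrimeTotallySplitProofs
import Literature.NumberTheory.EllipticCurves.CastellaGrossiLeeSkinner2022.HeegnerPointKolyvaginSystem
import HarnessLib

/-!
# The prime sets of the pushforward: `𝓛_s(T_𝔮) ⊆ 𝓛₁(𝐓)` (anticyclotomic twist, degree-two primes are totally split) and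
# `𝓛_E ⊆ 𝓛₀(T_𝔮)` — the inputs `hsub` / `hL` of the Kolyvagin-system link of the shared μ-crux (theorems only)

Topic `NumberTheory/EllipticCurves` (sequel of D1's `ZpExtensionEisensteinTwistUnramifiedTransferProofs` (`𝓛_s(T_𝔮) ⊆ ⋂_k 𝓛₁(E[p^{k+1}])`
read as explicit conditions), `ZpExtensionEisensteinSelmerUnramifiedProofs` (good reduction ⇒ `T_𝔮/p^k` unramified), lit's
`ZpExtensionShapiroSetting` (`shapiroTower`, `𝓛₁(𝐓) = AdicTower.kolyvaginPrimes p 𝐓 1`) and `CastellaGrossiLeeSkinner2022/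
HeegnerPointKolyvaginSystem` (`𝓛_E = heegnerKolyvaginPrimes`), and of `AnticyclotomicInertPrimeTotallySplitProofs` (Brink: a
`Gal(K/ℚ)`-stable place is totally split in an anticyclotomic `ℤ_p`-extension)).  Cell `pub/bsd-print-x9`, seat `bsd-line-x9-p2` g4;
lit g34's binder audit 19:28:41Z item (3): the two inclusions the `ksLink` clause of STUB A quantifies.

Howard, Def. 1.2.1 / Thm. 1.6.1 [arXiv:1202.6340 p. 6 L63–68, p. 11 L15–16]: the abstract theory over the DVR `S_𝔮` needs
«`𝓛_s(T_𝔮) ⊂ 𝓛` for `s ≫ 0`», while the Heegner-point Kolyvagin system lives on `𝓛 = 𝓛₁(𝐓)` (§2.3) — CGLS's `𝓛_E`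
(§3.2: inert `ℓ` with `a_ℓ ≡ ℓ + 1 ≡ 0 (mod p)`).  For `K` imaginary quadratic a degree-two prime `λ` IS `ℓ𝓞_K` (§1, norms), so
`Frob_λ ∈ Gal(K̄/K_∞)` for an ANTICYCLOTOMIC `κ` (Brink; tree `frobExponentAt_eq_zero_of_span_natCast`) and both twists — `Λ(κ)` on
`𝐓` and `S_𝔮(ψ)` on `T_𝔮` — are invisible to `Frob_λ`; the conditions `p ∣ ℓ + 1`, `Frob_λ ≡ 1 (mod p)` on `E[p^{k+1}]`
extracted from `λ ∈ 𝓛_s(T_𝔮)` by D1 (`kolyvaginPrimes_conditions_of_eisensteinTwist`) then give `λ ∈ 𝓛₁(𝐓)`.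
* §1 `IsDegreeTwo.asIdeal_eq_span_residueChar` (`[K:ℚ] = 2`): a degree-two prime is `(ℓ)`.
* §2 `ZpExtension.mem_kerSubgroup_of_isArithFrobAtPlace_of_isDegreeTwo`: every arithmetic Frobenius at a degree-two `λ ∤ p` lies
  in `ker κ` (`κ` anticyclotomic, `K` imaginary quadratic).
* §3 `WeierstrassCurve.isUnramifiedAt_shapiroTower_of_isUnramifiedAt` (`E[p^{j+1}]` unramified ⇒ `𝐓_j` unramified at `λ ∤ p`) and
  `ZpExtension.exists_coeffTwist_sub_eq_nsmul_of_mem_kerSubgroup` (on `ker κ` the twist acts through `1 ⊗ ρ`, so `Frob ≡ 1 (mod q)`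
  transfers from `M` to `M ⊗ A(χ)`).
* §4 **`WeierstrassCurve.kolyvaginPrimes_eisensteinTower_subset_kolyvaginPrimes_shapiroTower`**: `𝓛_s(T_𝔮) ⊆ 𝓛₁(𝐓)` for every
  `s ≥ 1` (both towers at the same anticyclotomic `κ`), and the `ksLink` form **`…_subset_heegnerKolyvaginPrimes`**:
  `∀ v ∈ 𝓛_s(T_𝔮), v ∉ S → v ∈ 𝓛_E`.
* §5 **`WeierstrassCurve.heegnerKolyvaginPrimes_subset_degreeTwoPrimes_eisensteinTower`**: `𝓛_E ⊆ 𝓛₀(T_𝔮)` (good reduction off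
  `S ⊇ {v ∣ p}`; the target `hL` of the pushforward `Hom` / of D1's setting).
Theorems only; no named fact, no instance, no notation, no `sorry`.  BSD is not proved by any of this.

References: [Howard2004HeegnerKolyvagin] §1.2, Def. 1.2.1, Thm. 1.6.1, §2.3, proof of Thm. 2.2.10; [CastellaGrossiLeeSkinner2022] §3.1–§3.2
(𝓛_E); [Brink2007] §III p. 2134; [Washington1997] Prop. 13.2; [Marcus2018] Ch. 3 Thm. 21–22 (norms of ideals, `efg = n`).
-/

noncomputable section

open scoped TensorProduct ContRepresentation NumberField
open Field IsDedekindDomain NumberField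

/-! ## §1 A degree-two prime of a quadratic field is a rational prime -/

namespace Literature.NumberTheory.GaloisCohomology.Howard2004

variable {K : Type} [Field K] [NumberField K]

/-- **A degree-two prime `λ` of a quadratic field `K` is `ℓ𝓞_K`** (`ℓ` its residue characteristic): `ℓ ∈ λ`, and the
ideals `ℓ𝓞_K ≤ λ` have the same index `ℓ² = N(ℓ) = ℓ^{[K:ℚ]}`, so the cofactor has norm `1`.
[cite: Marcus2018, Ch. 3, Thm. 22 (N(ℓ𝓞_K) = ℓ^n) and Thm. 21 (efg = n)] [cite: Howard2004HeegnerKolyvagin, §1.2 (degree-two primes: ℓ inert)] -/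
theorem IsDegreeTwo.asIdeal_eq_span_residueChar (hK2 : Module.finrank ℚ K = 2) {v : HeightOneSpectrum (𝓞 K)}
    (hv : IsDegreeTwo v) : v.asIdeal = Ideal.span {((residueChar v : ℕ) : 𝓞 K)} := by
  haveI : Finite (𝓞 K ⧸ v.asIdeal) := v.asIdeal.finiteQuotientOfFreeOfNeBot v.ne_bot
  letI : Field (𝓞 K ⧸ v.asIdeal) := Ideal.Quotient.field _
  have hℓ : (residueChar v).Prime := by
    unfold residueChar; exact CharP.char_is_prime (𝓞 K ⧸ v.asIdeal) _
  have hℓv : ((residueChar v : ℕ) : 𝓞 K) ∈ v.asIdeal := by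
    rw [← Ideal.Quotient.eq_zero_iff_mem, map_natCast]
    exact (ringChar.spec (𝓞 K ⧸ v.asIdeal) _).mpr dvd_rfl
  have hle : Ideal.span {((residueChar v : ℕ) : 𝓞 K)} ≤ v.asIdeal :=
    (Ideal.span_singleton_le_iff_mem _).mpr hℓv
  obtain ⟨c, hc⟩ := Ideal.dvd_iff_le.mpr hle
  have hN : Ideal.absNorm (Ideal.span {((residueChar v : ℕ) : 𝓞 K)}) = residueChar v ^ 2 := by
    rw [Ideal.absNorm_span_singleton, Algebra.norm_natCast, NumberField.RingOfIntegers.rank, hK2, ← Nat.cast_pow,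
      Int.natAbs_natCast]
  have hNv : Ideal.absNorm v.asIdeal = residueChar v ^ 2 := by
    rw [Ideal.absNorm_apply, Submodule.cardQuot_apply]
    exact hv
  have hc1 : Ideal.absNorm c = 1 := by
    have h := congrArg Ideal.absNorm hc
    rw [map_mul, hN, hNv] at h
    exact (mul_right_inj' (pow_ne_zero 2 hℓ.ne_zero)).mp (h.symm.trans (mul_one _).symm) |>.symm.symm
  rw [Ideal.absNorm_eq_one_iff] at hc1
  rw [hc, hc1, Ideal.mul_top]

end Literature.NumberTheory.GaloisCohomology.Howard2004

/-! ## §2 Arithmetic Frobenii at degree-two primes lie in `ker κ` (anticyclotomic `κ`) -/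

namespace Literature.NumberTheory.EllipticCurves.ZpExtension

open Literature.NumberTheory.GaloisRepresentations Literature.NumberTheory.GaloisCohomology.Howard2004

variable {K : Type} [Field K] [NumberField K] {p : ℕ} [hp : Fact p.Prime] (κ : ZpExtension K p)

/-- **Every arithmetic Frobenius at a degree-two prime `λ ∤ p` lies in `Gal(K̄/K_∞) = ker κ`** for an anticyclotomic
`ℤ_p`-extension of an imaginary quadratic `K`: `λ = ℓ𝓞_K` (§1) is `Gal(K/ℚ)`-stable, hence totally split in `K_∞` (Brink),
i.e. `c_λ = 0`, and `κ(Frob) = c_λ` for every arithmetic Frobenius above `λ`.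
[cite: Brink2007, §III p. 2134] [cite: Howard2004HeegnerKolyvagin, §1.2 (Kolyvagin primes) and §2.3] [cite: Washington1997, Prop. 13.2] -/
theorem mem_kerSubgroup_of_isArithFrobAtPlace_of_isDegreeTwo (hK : IsImaginaryQuadratic K) (hκ : κ.IsAnticyclotomic)
    {v : HeightOneSpectrum (𝓞 K)} (hpv : ((p : ℕ) : 𝓞 K) ∉ v.asIdeal) (hv : IsDegreeTwo v)
    {σ : absoluteGaloisGroup K} (hσ : IsArithFrobAtPlace K v σ) : σ ∈ κ.kerSubgroup := by
  obtain ⟨𝔓, h𝔓, hΦ⟩ := hσ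
  rw [ZpExtension.mem_kerSubgroup, κ.apply_eq_frobExponentAt_of_isArithFrobAt hpv h𝔓 hΦ,
    κ.frobExponentAt_eq_zero_of_span_natCast hK hκ hpv (hv.asIdeal_eq_span_residueChar hK.1)]
  rfl

/-! ## §3 Transfer of unramifiedness and of `Frob ≡ 1 (mod q)` from `M` to `M ⊗ A(χ)` on `ker κ` -/

omit [NumberField K] in
/-- **On `ker κ` the twist acts through `1 ⊗ ρ`, so `Frob σ ≡ 1 (mod q)` transfers from `M` to `M ⊗ A(χ_u)`**:
if `σ a − a ∈ q·M` for all `a`, then `σ x − x ∈ q·(M ⊗ A)` for all `x` (pure tensors, then sums).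
[cite: Howard2004HeegnerKolyvagin, Def. 1.2.1 (Frob_λ acts trivially on T/I_ℓ T) and §2.2] [cite: Washington1997, §13.1–§13.2] -/
theorem exists_coeffTwist_sub_eq_nsmul_of_mem_kerSubgroup {N : Type} [AddCommGroup N] [TopologicalSpace N]
    [DiscreteTopology N] (ρN : DiscreteGaloisModule K N) {A : Type} [CommRing A] {u : A} {j : ℕ}
    (hu : u ^ (p ^ j) = 1) {σ : absoluteGaloisGroup K} (hσ : σ ∈ κ.kerSubgroup) {q : ℕ}
    (hρ : ∀ a : N, ∃ b : N, ρN σ a - a = q • b) (x : CoeffExtension ℤ A N) :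
    ∃ y : CoeffExtension ℤ A N, κ.coeffTwist ρN u j hu σ x - x = q • y := by
  induction x using CoeffExtension.induction_on with
  | zero => exact ⟨0, by rw [map_zero, sub_zero, smul_zero]⟩
  | tmul c a =>
    obtain ⟨b, hb⟩ := hρ a
    refine ⟨CoeffExtension.tmul c b, ?_⟩
    rw [κ.coeffTwist_apply_tmul_of_mem_kerSubgroup ρN hu hσ]
    change (TensorProduct.mk ℤ A N c) (ρN σ a) - (TensorProduct.mk ℤ A N c) a = q • (TensorProduct.mk ℤ A N c) b
    rw [← map_sub, hb, map_nsmul]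
  | add x y hx hy =>
    obtain ⟨x', hx'⟩ := hx
    obtain ⟨y', hy'⟩ := hy
    exact ⟨x' + y', by rw [map_add, add_sub_add_comm, hx', hy', smul_add]⟩

end Literature.NumberTheory.EllipticCurves.ZpExtension

namespace WeierstrassCurve

open Literature.NumberTheory.EllipticCurves Literature.NumberTheory.GaloisRepresentations
open Literature.NumberTheory.GaloisCohomology Literature.NumberTheory.GaloisCohomology.Howard2004
open Literature.NumberTheory.EllipticCurves.ZpExtension
open Literature.NumberTheory.EllipticCurves.IwasawaAlgebra

variable {K : Type} [Field K] [NumberField K] (W : WeierstrassCurve ℚ) [W.IsElliptic] {p : ℕ} [hp : Fact p.Prime]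
  (κ : ZpExtension K p)

/-- **`𝐓_j` is unramified at `λ ∤ p` as soon as `E_K[p^{j+1}]` is**: inertia at `λ` lies in `ker κ` (Washington 13.2, tree
`inertia_le_kerSubgroup_holds`), where the twist acts through `1 ⊗ ρ_E`. [cite: Washington1997, Prop. 13.2] [cite: Howard2004HeegnerKolyvagin, §1.2 (𝓛₀) and §2.2] -/
theorem isUnramifiedAt_shapiroTower_of_isUnramifiedAt {v : HeightOneSpectrum (𝓞 K)} (hpv : ((p : ℕ) : 𝓞 K) ∉ v.asIdeal)
    (j : ℕ) (hE : GaloisRep.IsUnramifiedAt v ((W.baseChange K).torsionGaloisModule ((p : ℤ) ^ (j + 1)))) :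
    GaloisRep.IsUnramifiedAt v ((W.shapiroTower K p κ).ρ j) := by
  intro 𝔓 h𝔓 τ hτ
  have hτk : τ ∈ κ.kerSubgroup := ZpExtension.inertia_le_kerSubgroup_holds K p κ hpv h𝔓 hτ
  have hP : ∀ P : geomTorsion (W.baseChange K) ((p : ℤ) ^ (j + 1)),
      (W.baseChange K).torsionGaloisModule ((p : ℤ) ^ (j + 1)) τ P = P :=
    fun P ↦ LinearMap.congr_fun (hE 𝔓 h𝔓 τ hτ) P
  refine LinearMap.ext fun x ↦ ?_
  change (W.shapiroTower K p κ).ρ j τ x = x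
  exact κ.coeffTwist_apply_eq_self_of_mem_kerSubgroup ((W.baseChange K).torsionGaloisModule ((p : ℤ) ^ (j + 1)))
    (mk_one_add_X_pow_prime_pow_eq_one (shapiroIdeal p (j + 1)) (omega_mem_shapiroIdeal p (j + 1))) hτk hP x

/-- **`Frob_λ ≡ 1 (mod p)` transfers from `E_K[p^{j+1}]` to `𝐓_j`** for `σ ∈ ker κ` (the `Λ`-ideal `(p)` acting through
`Λ ↠ Λ/(ω_{j+1}, p^{j+1})`). [cite: Howard2004HeegnerKolyvagin, Def. 1.2.1 and §2.3 (𝓛₁(𝐓))] -/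
theorem shapiroTower_apply_sub_mem_of_mem_kerSubgroup (j : ℕ) {σ : absoluteGaloisGroup K} (hσ : σ ∈ κ.kerSubgroup)
    (hF : ∀ P : geomTorsion (W.baseChange K) ((p : ℤ) ^ (j + 1)),
      ∃ Q : geomTorsion (W.baseChange K) ((p : ℤ) ^ (j + 1)), σ • P - P = p • Q)
    (x : W.ShapiroLevel K p j) :
    (W.shapiroTower K p κ).ρ j σ x - x ∈
      (Ideal.span {((p : ℕ) : IwasawaAlgebra p) ^ 1} • (⊤ : Submodule (IwasawaAlgebra p) (W.ShapiroLevel K p j)) :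
        Submodule (IwasawaAlgebra p) (W.ShapiroLevel K p j)) := by
  rw [mem_ideal_span_natCast_pow_smul_top_iff, pow_one]
  exact κ.exists_coeffTwist_sub_eq_nsmul_of_mem_kerSubgroup ((W.baseChange K).torsionGaloisModule ((p : ℤ) ^ (j + 1)))
    (mk_one_add_X_pow_prime_pow_eq_one (shapiroIdeal p (j + 1)) (omega_mem_shapiroIdeal p (j + 1))) hσ
    (fun P ↦ by
      obtain ⟨Q, hQ⟩ := hF P
      exact ⟨Q, by rw [torsionGaloisModule_apply_apply, hQ]⟩) x

/-! ## §4 `𝓛_s(T_𝔮) ⊆ 𝓛₁(𝐓)` and the `ksLink` form `𝓛_s(T_𝔮) ∖ S ⊆ 𝓛_E` -/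

variable {m : ℕ} (hm : 1 ≤ m)

/-- **The explicit content of `λ ∈ 𝓛_s(T_𝔮)` on the curve, for the Eisenstein tower of `E_K`** (D1's
`kolyvaginPrimes_conditions_of_eisensteinTwist` level by level): for every `k`, `λ ∈ 𝓛₀(E_K[p^{k+1}])`, `p ∣ ℓ + 1`, and
`Frob_λ P − P ∈ p·E_K[p^{k+1}]`. [cite: Howard2004HeegnerKolyvagin, Def. 1.2.1 and Thm. 1.6.1] [cite: Washington1997, Prop. 13.2] -/
theorem kolyvaginPrimes_eisensteinTower_conditions {s : ℕ} (hs : 1 ≤ s) {v : HeightOneSpectrum (𝓞 K)}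
    (hv : letI := IwasawaAlgebra.isLocalRing_quotient_X_pow_add_C p hm
      v ∈ (W.eisensteinTower κ hm).kolyvaginPrimes p s) (k : ℕ) :
    v ∈ Howard2004.degreeTwoPrimes p ((W.baseChange K).torsionGaloisModule ((p : ℤ) ^ (k + 1))) ∧
      p ∣ residueChar v + 1 ∧
      ∀ σ : absoluteGaloisGroup K, IsArithFrobAtPlace K v σ →
        ∀ P : geomTorsion (W.baseChange K) ((p : ℤ) ^ (k + 1)),
          ∃ Q : geomTorsion (W.baseChange K) ((p : ℤ) ^ (k + 1)), σ • P - P = p • Q := by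
  letI := IwasawaAlgebra.isLocalRing_quotient_X_pow_add_C p hm
  obtain ⟨h0, h1, h2⟩ := hv
  have h0k := Set.mem_iInter.mp h0 k
  have h1' : ((residueChar v + 1 : ℕ) : EisensteinCoeff p m (k + 1)) ∈
      Ideal.span {((p : ℕ) : EisensteinCoeff p m (k + 1)) ^ 1} := by
    rw [pow_one, Ideal.mem_span_singleton]
    exact Nat.cast_dvd_cast (IwasawaAlgebra.dvd_of_natCast_mem_span_pow_quotient p hm hs h1)
  exact (W.baseChange K).kolyvaginPrimes_conditions_of_eisensteinTwist κ hm (Nat.succ_pos k) le_rfl h0k h1'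
    (fun σ hσ x ↦ by
      obtain ⟨y, hy⟩ := (mem_ideal_span_natCast_pow_smul_top_iff _ _ _).mp (h2 k σ hσ x)
      have hy' : κ.eisensteinTwist ((W.baseChange K).torsionGaloisModule ((p : ℤ) ^ (k + 1))) hm (k + 1) σ x - x =
          p ^ s • (EisensteinLevel.equivTwisted (k + 1) y) := hy
      exact (mem_ideal_span_natCast_pow_smul_top_iff _ _ _).mpr
        ⟨p ^ (s - 1) • EisensteinLevel.equivTwisted (k + 1) y, by
          rw [hy', pow_one, ← mul_nsmul, ← pow_succ, Nat.sub_add_cancel hs]⟩)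

/-- **`𝓛_s(T_𝔮) ⊆ 𝓛₁(𝐓)` for every `s ≥ 1`** (both towers of `E_K` at the same ANTICYCLOTOMIC `κ`, `K` imaginary quadratic):
a Kolyvagin prime of Howard's Eisenstein tower is a degree-two prime `λ = ℓ𝓞_K ∤ p` with `p ∣ ℓ + 1` and `Frob_λ ≡ 1 (mod p)` on
every `E_K[p^{k+1}]` (D1); `Frob_λ ∈ ker κ` (§2), so the same holds on every `𝐓_j = E_K[p^{j+1}] ⊗ Λ/(ω_{j+1},p^{j+1})(κ)`, which is
unramified at `λ` (§3): Howard's «`𝓛_s(T) ⊂ 𝓛`» with `𝓛 = 𝓛₁(𝐓)` (§2.3) — the `LargePrimes` input of Thm. 1.6.1 for `T_𝔮`.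
[cite: Howard2004HeegnerKolyvagin, Def. 1.2.1, Thm. 1.6.1 (arXiv p. 11, L15–16), §2.3 (𝓛 = 𝓛₁(𝐓)) and proof of Thm. 2.2.10] [cite: Brink2007, §III p. 2134] -/
theorem kolyvaginPrimes_eisensteinTower_subset_kolyvaginPrimes_shapiroTower (hK : IsImaginaryQuadratic K)
    (hκ : κ.IsAnticyclotomic) {s : ℕ} (hs : 1 ≤ s) :
    letI := IwasawaAlgebra.isLocalRing_quotient_X_pow_add_C p hm
    (W.eisensteinTower κ hm).kolyvaginPrimes p s ⊆ (W.shapiroTower K p κ).kolyvaginPrimes p 1 := by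
  letI := IwasawaAlgebra.isLocalRing_quotient_X_pow_add_C p hm
  intro v hv
  have hE := W.kolyvaginPrimes_eisensteinTower_conditions κ hm hs hv
  refine ⟨Set.mem_iInter.mpr fun j ↦ ?_, ?_, fun j σ hσ x ↦ ?_⟩
  · obtain ⟨⟨h2, hpv, hur⟩, -, -⟩ := hE j
    exact ⟨h2, hpv, W.isUnramifiedAt_shapiroTower_of_isUnramifiedAt κ hpv j hur⟩
  · obtain ⟨-, hdvd, -⟩ := hE 0
    rw [pow_one, Ideal.mem_span_singleton]
    exact Nat.cast_dvd_cast hdvd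
  · obtain ⟨⟨h2, hpv, -⟩, -, hF⟩ := hE j
    exact W.shapiroTower_apply_sub_mem_of_mem_kerSubgroup κ j
      (κ.mem_kerSubgroup_of_isArithFrobAtPlace_of_isDegreeTwo hK hκ hpv h2 hσ) (hF σ hσ) x

/-- **`𝓛_s(T_𝔮) ∖ S ⊆ 𝓛_E`** (`𝓛_E = 𝓛₁(𝐓) ∖ S`, CGLS §3.2 / Howard §2.3) for every `s ≥ 1` — the binder `hsub` of the `ksLink`
clause of STUB A (with it, D1's `eisensteinDVRSetting_largePrimes` gives `LargePrimes` for the target of the pushforward at `𝓛 := 𝓛_E`).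
[cite: Howard2004HeegnerKolyvagin, Thm. 1.6.1 (𝓛_s(T) ⊂ 𝓛 for s ≫ 0) and §2.3] [cite: CastellaGrossiLeeSkinner2022, §3.2 (𝓛_E)] -/
theorem kolyvaginPrimes_eisensteinTower_subset_heegnerKolyvaginPrimes (hK : IsImaginaryQuadratic K)
    (hκ : κ.IsAnticyclotomic) (S : Finset (HeightOneSpectrum (𝓞 K))) {s : ℕ} (hs : 1 ≤ s) :
    letI := IwasawaAlgebra.isLocalRing_quotient_X_pow_add_C p hm
    ∀ v ∈ (W.eisensteinTower κ hm).kolyvaginPrimes p s, v ∉ S →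
      v ∈ CastellaGrossiLeeSkinner2022.heegnerKolyvaginPrimes W κ S :=
  fun _ hv hvS ↦ ⟨W.kolyvaginPrimes_eisensteinTower_subset_kolyvaginPrimes_shapiroTower κ hm hK hκ hs hv, hvS⟩

/-! ## §5 `𝓛_E ⊆ 𝓛₀(T_𝔮)` -/

/-- **`𝓛_E ⊆ 𝓛₀(T_𝔮)`**: a prime of `𝓛_E = 𝓛₁(𝐓) ∖ S` is a degree-two prime `∤ p` off `S`, where `E_K` has good reduction, so
every level `E_K[p^{k+1}] ⊗ A_{m,k+1}(ψ)` of Howard's Eisenstein tower is unramified there (D1's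
`isUnramifiedAt_eisensteinTwist_torsionGaloisModule`) — the hypothesis `hL : 𝓛 ⊆ 𝓛₀` of D1's `eisensteinDVRSetting…` at `𝓛 := 𝓛_E`,
for ANY `ℤ_p`-extension `κ'` on the target side. [cite: Howard2004HeegnerKolyvagin, §1.2 (𝓛 ⊂ 𝓛₀, arXiv p. 6 L96–100) and §2.3] [cite: CastellaGrossiLeeSkinner2022, §3.1 (𝓛 ⊂ 𝓛₀)] -/
theorem heegnerKolyvaginPrimes_subset_degreeTwoPrimes_eisensteinTower (κ' : ZpExtension K p)
    (S : Finset (HeightOneSpectrum (𝓞 K)))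
    (hbad : ∀ v : HeightOneSpectrum (𝓞 K), v ∉ S → ((p : ℕ) : 𝓞 K) ∉ v.asIdeal → (W.baseChange K).HasGoodReductionAt v) :
    letI := IwasawaAlgebra.isLocalRing_quotient_X_pow_add_C p hm
    CastellaGrossiLeeSkinner2022.heegnerKolyvaginPrimes W κ S ⊆ (W.eisensteinTower κ' hm).degreeTwoPrimes p := by
  letI := IwasawaAlgebra.isLocalRing_quotient_X_pow_add_C p hm
  intro v hv
  have h0 := Set.mem_iInter.mp hv.1.1 0
  have hpv : ((p : ℕ) : 𝓞 K) ∉ v.asIdeal := h0.2.1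
  have hgood : (W.baseChange K).HasGoodReductionAt v := hbad v hv.2 hpv
  refine Set.mem_iInter.mpr fun k ↦ ⟨h0.1, hpv, ?_⟩
  exact (W.baseChange K).isUnramifiedAt_eisensteinTwist_torsionGaloisModule κ' hm hgood hpv (k + 1)

end WeierstrassCurve

end
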